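import Literature.NumberTheory.EllipticCurves.ModularDegreeSpectralLevelBound
import Literature.NumberTheory.EllipticCurves.SzpiroFreyProofs
import Literature.NumberTheory.DiophantineGeometry.MinimalDiscriminantNormProofs
import Literature.NumberTheory.DiophantineGeometry.MinimalDiscriminantProofs
import Literature.NumberTheory.DiophantineGeometry.ConductorRadicalProofs
import Literature.NumberTheory.DiophantineGeometry.AbcWave0SUnitProofs
import Literature.NumberTheory.DiophantineGeometry.AbcWave0QualityFormProofs
import Literature.Barriers.ABC.BakerMethodBoundsEpsShape
import HarnessLib

/-!
# The modular method reaches `EpsShapeBound 1` in kernel: Pasten's Thm 7.5 (hence modularity +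
# Mazur–Kenku + the spectral degree bound Thm 7.2) ⟹ `log c ≪_ε rad(abc)^{1+ε}` (proofs)

Topic `Literature/NumberTheory/EllipticCurves` (family `abc`, LADDER-ABC A1, candidate rung A1.P: the
*modular method*). Theorems only — NO new statement (D-0026). This file supplies the step "N1" of the
idea card `A1.P` (HOME/lit-abc-pasten/IDEA-A1P-modular-method-rung.md of cell abc-stewartyu):

* `exists_frey_model_sq_dvd` — for every `abc` triple a global minimal Frey model `W₀/ℤ` with
  `N ∣ 2¹⁰ rad(abc)` and `(abc)² ∣ 2⁸ |Δ_min|` (Bombieri–Gubler Ex. 12.5.10 (12.17)/(12.18); the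
  `Δ`-companion of `exists_minimal_frey_model`).
* `epsShapeBound_one_of_pasten_thm_7_5 : pasten_thm_7_5 → Literature.Barriers.ABC.EpsShapeBound 1` —
  Pasten 2024 Thm 7.5 (typed fact, `PastenValuationProduct.lean`) gives the tree's rung `EpsShapeBoundOne`
  (there PROVED unconditionally via `p`-adic linear forms, `Summit.ABC…epsShapeBoundOne_holds`) by the
  Frey-curve translation of Murty–Pasten §8, with Mahler's finiteness (PROVED,
  `finite_setOf_isABCTriple_primeFactors_subset_holds`) absorbing the curves of small conductor into the
  threshold `c₀`.
* `epsShapeBound_one_of_modularity_of_thm_7_2` — composed with `pasten_thm_7_5_of_thm_7_2`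
  (`ModularDegreeSpectralLevelBound.lean`): **`EpsShapeBound 1` BY NAME from the three elliptic-curve
  facts** `nonempty_modularParametrizationData` (BCDT modularity with an integral Manin constant),
  `PastenShimura2024_minimalDegree_le_163_mul` (Mazur–Kenku) and `PastenShimura2024_thm_7_2_asymptotic`
  (Pasten's spectral bound for `δ_{1,N}`) — the kernel form of the modular-method rung A1.P (a second,
  technique-disjoint derivation of `A1.M2⁻`; no linear forms in logarithms anywhere in its cone).

## References

* [PastenShimura2024] H. Pasten, J. Number Theory 254 (2024) = arXiv:1705.09251, §3 and Thm 7.5.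
* [MurtyPasten2013] M. R. Murty, H. Pasten, J. Number Theory 133 (2013), §8 (Frey curve:
  `2⁸|Δ_E| ≥ (ABC)²`, `N_E ∣ 2⁴ rad(ABC)`).
* [BombieriGubler2006] E. Bombieri, W. Gubler, *Heights in Diophantine Geometry*, Ex. 12.5.10,
  Thm. 12.5.12.
-/

noncomputable section

open WeierstrassCurve UniqueFactorizationMonoid IsDedekindDomain

namespace Literature.NumberTheory.EllipticCurves

open DiophantineGeometry ModularForms

/-- **The Frey–Hellegouarch model of an `abc` triple, discriminant form** (Bombieri–Gubler
Ex. 12.5.10 / Murty–Pasten §8: "`2⁸|Δ_E| ≥ (ABC)²`"): every `abc` triple carries a global minimal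
integral Weierstrass model `W₀` of a Frey curve — (12.17) if `16 ∤ abc` (`Δ = 16(abc)²`), (12.18) for
Serre's arrangement if `16 ∣ abc` (`Δ = (abc)²/2⁸`) — with `N ∣ 2¹⁰ rad(abc)` and
`(abc)² ∣ 2⁸ |Δ_min|`. PROVED (companion of `exists_minimal_frey_model`, which records `c₄` instead
of `Δ`). [cite: BombieriGubler2006, Ex. 12.5.10] [cite: MurtyPasten2013, §8 (proof of Thm 1.2: 2⁸|Δ_E| ≥ (ABC)²)] -/
theorem exists_frey_model_sq_dvd {a b c : ℕ} (h : IsABCTriple a b c) :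
    ∃ W₀ : WeierstrassCurve ℤ, (W₀.baseChange ℚ).IsElliptic ∧
      (W₀.baseChange ℚ).conductorNorm ℤ ∣ 2 ^ 10 * rad a b c ∧
      (a * b * c) ^ 2 ∣ 2 ^ 8 * (W₀.baseChange ℚ).minimalDiscriminantNorm ℤ := by
  have h' := h
  obtain ⟨ha, hb, habc, hcop⟩ := h'
  have hc : 0 < c := by omega
  have habc0 : a * b * c ≠ 0 := by positivity
  by_cases h16 : 16 ∣ a * b * c
  · obtain ⟨A, B, hAB, hA, hB, hprod, -⟩ := exists_arrangement h h16
    have h0 : A * B * (A + B) ≠ 0 := by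
      rw [← Int.natAbs_ne_zero, hprod]; exact habc0
    have h4 : 4 ∣ B - A - 1 := by
      have : B - A - 1 = B - (A + 1) := by ring
      rw [this]; exact dvd_sub (dvd_trans (by norm_num) hB) hA
    have h16' : 16 ∣ A * B := dvd_mul_of_dvd_right hB _
    haveI := isElliptic_freyIntModel₂ h0 h4 h16'
    refine ⟨freyIntModel₂ A B, isElliptic_freyIntModel₂ h0 h4 h16', ?_, ?_⟩
    · rw [rad_def, ← hprod]
      exact (conductorNorm_freyIntModel₂_dvd hAB h0 hA hB).trans (dvd_mul_left _ _)
    · have hΔ : (freyIntModel₂ A B).Δ = (A * B / 16) ^ 2 * (A + B) ^ 2 := freyIntModel₂_Δ h4 h16'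
      have hΔ0 : (freyIntModel₂ A B).Δ ≠ 0 := Δ_ne_zero_of_isElliptic_baseChange_int _
      rw [minimalDiscriminantNorm_eq_natAbs_holds _ hΔ0 (isMinimalAt_freyIntModel₂ hAB hA hB), hΔ,
        ← hprod]
      obtain ⟨e, he⟩ := h16'
      have he' : A * B / 16 = e := by rw [he]; simp
      rw [he']
      have key : (2 : ℤ) ^ 8 * (e ^ 2 * (A + B) ^ 2) = (A * B * (A + B)) ^ 2 := by rw [he]; ring
      have : (A * B * (A + B)).natAbs ^ 2 = 2 ^ 8 * (e ^ 2 * (A + B) ^ 2).natAbs := by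
        have := congrArg Int.natAbs key
        rw [Int.natAbs_mul, Int.natAbs_pow, Int.natAbs_pow] at this
        simpa using this.symm
      rw [this]
  · have hab : IsCoprime (a : ℤ) (b : ℤ) := Nat.isCoprime_iff_coprime.mpr hcop
    have hP : (a : ℤ) * b * (a + b) = ((a * b * c : ℕ) : ℤ) := by rw [← habc]; push_cast; ring
    have h0 : (a : ℤ) * b * (a + b) ≠ 0 := by rw [hP]; exact_mod_cast habc0
    have h16' : ¬ (16 : ℤ) ∣ (a : ℤ) * b * (a + b) := by
      rw [hP]; exact_mod_cast mt Int.natCast_dvd_natCast.mp h16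
    haveI := isElliptic_freyIntModel h0
    refine ⟨freyIntModel a b, isElliptic_freyIntModel h0, ?_, ?_⟩
    · have := conductorNorm_freyIntModel_dvd hab h0 h16'
      rwa [hP, Int.natAbs_natCast, ← rad_def] at this
    · have hΔ0 : (freyIntModel (a : ℤ) b).Δ ≠ 0 := by
        rw [freyIntModel_Δ]; positivity
      rw [minimalDiscriminantNorm_eq_natAbs_holds _ hΔ0 (isMinimalAt_freyIntModel hab h0 h16'),
        freyIntModel_Δ, hP]
      refine ⟨2 ^ 12, ?_⟩
      have : ((16 : ℤ) * (((a * b * c : ℕ) : ℤ)) ^ 2).natAbs = 16 * (a * b * c) ^ 2 := by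
        rw [Int.natAbs_mul, Int.natAbs_pow, Int.natAbs_natCast]; rfl
      rw [this]; ring


/-- **`EpsShapeBound 1` from Pasten's Thm 7.5 by the modular method** (PROVED): the typed fact
`pasten_thm_7_5` (*"for all `E/ℚ` of conductor `N ≫_ε 1`, `log|Δ_E| < (1/4 + ε) N log N`"*, Pasten
2024 Thm 7.5) implies `log c ≤ (10⁴/ε) · rad(abc)^{1+ε}` for all `abc` triples with `c ≥ c₀(ε)`, i.e.
`Literature.Barriers.ABC.EpsShapeBound 1` (the rung `A1.M2⁻`, `EpsShapeBoundOne`). Proof (Murty–Pasten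
§8 / Frey): for the Frey model `W₀` of `exists_frey_model_sq_dvd`, `2 log c ≤ 8 log 2 + log|Δ_min|`,
`N ≤ 2¹⁰ rad(abc)`; Pasten's bound applies once `N ≥ N₀(1)`, which holds as soon as `abc` has a prime
factor `p ≥ 2(N₀ + 2)` (such a `p` is odd, divides `Δ_min`, hence `N`, since `N` and `Δ_min` have the
same prime factors, `radical_conductorNorm_eq_holds`); the finitely many triples all of whose primes
are `< 2(N₀+2)` (Mahler, `finite_setOf_isABCTriple_primeFactors_subset_holds`) are excluded by the
threshold `c₀`. Constants: `2 log c < 8 log 2 + (5/4)·2¹⁰R·(10 log 2 + log R) ≤ 2·10⁴ R log R`, then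
`log R ≤ R^ε/ε`. [cite: PastenShimura2024, Thm 7.5 with §3 (Frey–Hellegouarch curves, "Szpiro's conjecture implies abc")] [cite: MurtyPasten2013, §8] -/
theorem epsShapeBound_one_of_pasten_thm_7_5 (h75 : pasten_thm_7_5) :
    Literature.Barriers.ABC.EpsShapeBound 1 := by
  intro ε hε
  obtain ⟨N₀, hN₀⟩ := h75 1 one_pos
  set M : ℕ := N₀ + 2 with hM
  -- Mahler: the triples all of whose primes are `< 2M` form a finite set; bound their `c`
  have hfin := finite_setOf_isABCTriple_primeFactors_subset_holds (Finset.range (2 * M))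
  obtain ⟨B, hB⟩ := (hfin.image fun t : ℕ × ℕ × ℕ => t.2.2).bddAbove
  refine ⟨10000 / ε, (B : ℝ) + 1, fun a b c ht hc₀ => ?_⟩
  have ht' := ht
  obtain ⟨ha, hb, habc, hcop⟩ := ht'
  have hc : 0 < c := by omega
  -- a prime factor `p ≥ 2M` of `abc`
  have hnot : ¬ (a * b * c).primeFactors ⊆ Finset.range (2 * M) := by
    intro hsub
    have hmem : c ∈ (fun t : ℕ × ℕ × ℕ => t.2.2) ''
        {t : ℕ × ℕ × ℕ | IsABCTriple t.1 t.2.1 t.2.2 ∧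
          (t.1 * t.2.1 * t.2.2).primeFactors ⊆ Finset.range (2 * M)} :=
      ⟨(a, b, c), ⟨ht, hsub⟩, rfl⟩
    have h1 : c ≤ B := hB hmem
    have h2 : (c : ℝ) ≤ B := by exact_mod_cast h1
    linarith
  obtain ⟨p, hp, hpM⟩ := Finset.not_subset.mp hnot
  have hpP : p.Prime := Nat.prime_of_mem_primeFactors hp
  have hpdvd : p ∣ a * b * c := Nat.dvd_of_mem_primeFactors hp
  have hp2M : 2 * M ≤ p := by simpa [Finset.mem_range] using hpM
  -- the Frey model and Pasten's bound at its conductor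
  obtain ⟨W₀, hE, hN, hΔ⟩ := exists_frey_model_sq_dvd ht
  haveI := hE
  have hΔpos : 0 < (W₀.baseChange ℚ).minimalDiscriminantNorm ℤ := minimalDiscriminantNorm_pos_holds _
  have hNpos : 0 < (W₀.baseChange ℚ).conductorNorm ℤ := conductorNorm_pos_holds _
  have hp2 : p ≠ 2 := by omega
  have hpΔ : p ∣ (W₀.baseChange ℚ).minimalDiscriminantNorm ℤ := by
    have h1 : p ∣ 2 ^ 8 * (W₀.baseChange ℚ).minimalDiscriminantNorm ℤ :=
      hpdvd.trans ((dvd_pow_self _ two_ne_zero).trans hΔ)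
    have hcop2 : Nat.Coprime p (2 ^ 8) :=
      Nat.Coprime.pow_right 8 ((Nat.coprime_primes hpP Nat.prime_two).mpr hp2)
    exact hcop2.dvd_of_dvd_mul_left h1
  have hpN : p ∈ ((W₀.baseChange ℚ).conductorNorm ℤ).primeFactors := by
    have hrad := (W₀.baseChange ℚ).radical_conductorNorm_eq_holds
    rw [natRadical_eq_iff] at hrad
    rw [hrad]
    exact Nat.mem_primeFactors.mpr ⟨hpP, hpΔ, hΔpos.ne'⟩
  have hNge : N₀ ≤ (W₀.baseChange ℚ).conductorNorm ℤ :=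
    le_trans (by omega) (hp2M.trans (Nat.le_of_mem_primeFactors hpN))
  have h75' := hN₀ (W₀.baseChange ℚ) hNge
  -- real-number bookkeeping (cast facts first, then abbreviate)
  have hradpos : 0 < rad a b c := by rw [rad_def]; exact Nat.radical_pos _
  have hR2 : (2 : ℝ) ≤ (rad a b c : ℝ) := by exact_mod_cast IsABCTriple.two_le_rad ht
  have hN1 : (1 : ℝ) ≤ ((W₀.baseChange ℚ).conductorNorm ℤ : ℝ) := by exact_mod_cast hNpos
  have hD0 : (0 : ℝ) < ((W₀.baseChange ℚ).minimalDiscriminantNorm ℤ : ℝ) := by exact_mod_cast hΔpos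
  have hNR : ((W₀.baseChange ℚ).conductorNorm ℤ : ℝ) ≤ 1024 * (rad a b c : ℝ) := by
    have := Nat.le_of_dvd (mul_pos (by positivity) hradpos) hN
    exact_mod_cast this
  have hc2 : (c : ℝ) ^ 2 ≤ 2 ^ 8 * ((W₀.baseChange ℚ).minimalDiscriminantNorm ℤ : ℝ) := by
    have h1 : c ≤ a * b * c := Nat.le_mul_of_pos_left c (by positivity)
    have h2 : (a * b * c) ^ 2 ≤ 2 ^ 8 * (W₀.baseChange ℚ).minimalDiscriminantNorm ℤ :=
      Nat.le_of_dvd (by positivity) hΔ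
    have h3 : c ^ 2 ≤ 2 ^ 8 * (W₀.baseChange ℚ).minimalDiscriminantNorm ℤ :=
      (Nat.pow_le_pow_left h1 2).trans h2
    exact_mod_cast h3
  set N : ℝ := ((W₀.baseChange ℚ).conductorNorm ℤ : ℝ) with hNdef
  set D : ℝ := ((W₀.baseChange ℚ).minimalDiscriminantNorm ℤ : ℝ) with hDdef
  set R : ℝ := (rad a b c : ℝ) with hRdef
  have hl2 := Real.log_two_lt_d9
  have hl2' := Real.log_two_gt_d9
  have hlogc : 2 * Real.log c ≤ 8 * Real.log 2 + Real.log D := by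
    have h1 : Real.log ((c : ℝ) ^ 2) ≤ Real.log (2 ^ 8 * D) :=
      Real.log_le_log (by positivity) hc2
    rw [Real.log_pow, Real.log_mul (by positivity) hD0.ne', Real.log_pow] at h1
    push_cast at h1
    linarith
  have hL : Real.log 2 ≤ Real.log R := Real.log_le_log (by norm_num) hR2
  have hlogN : Real.log N ≤ 10 * Real.log 2 + Real.log R := by
    have h1 : Real.log N ≤ Real.log (1024 * R) := Real.log_le_log (by linarith) hNR
    rw [Real.log_mul (by norm_num) (by linarith), show (1024 : ℝ) = 2 ^ 10 by norm_num,
      Real.log_pow] at h1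
    push_cast at h1
    linarith
  have hNlogN : N * Real.log N ≤ 1024 * R * (10 * Real.log 2 + Real.log R) :=
    mul_le_mul hNR hlogN (Real.log_nonneg hN1) (by positivity)
  -- with `X = R log R ≥ 2 log 2 > 1.38`: `log c ≤ 10000 X`
  have hX : 2 * Real.log 2 ≤ R * Real.log R := mul_le_mul hR2 hL (by linarith) (by linarith)
  have hRX : R ≤ 2 * (R * Real.log R) := by nlinarith
  have hmain : Real.log c ≤ 10000 * (R * Real.log R) := by
    have h1 : Real.log D < (1 / 4 + 1) * N * Real.log N := h75'
    nlinarith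
  -- `log R ≤ R^ε / ε`
  have hR0 : (0 : ℝ) < R := by linarith
  have hlogR : Real.log R ≤ R ^ ε / ε := Real.log_le_rpow_div hR0.le hε
  calc Real.log c ≤ 10000 * (R * Real.log R) := hmain
    _ ≤ 10000 * (R * (R ^ ε / ε)) := by gcongr
    _ = 10000 / ε * (R ^ (1 : ℝ) * R ^ ε) := by rw [Real.rpow_one]; ring
    _ = 10000 / ε * R ^ (1 + ε : ℝ) := by rw [← Real.rpow_add hR0]


/-- **Rung A1.P in kernel form** (PROVED): `EpsShapeBound 1` from modularity with an integral Manin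
constant, Mazur–Kenku, and Pasten's spectral bound Thm 7.2 (`D = 1`, asymptotic clause) — the modular
method end to end, relative to these three named facts (`pasten_thm_7_5_of_thm_7_2` then
`epsShapeBound_one_of_pasten_thm_7_5`). [cite: PastenShimura2024, Thm 7.2, Thm 7.5 and §3] -/
theorem epsShapeBound_one_of_modularity_of_thm_7_2 (hmod : nonempty_modularParametrizationData)
    (h163 : PastenShimura2024_minimalDegree_le_163_mul) (h72 : PastenShimura2024_thm_7_2_asymptotic) :
    Literature.Barriers.ABC.EpsShapeBound 1 :=
  epsShapeBound_one_of_pasten_thm_7_5 (pasten_thm_7_5_of_thm_7_2 hmod h163 h72)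

end Literature.NumberTheory.EllipticCurves

end
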